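import Summits.CriticalPhenomena.PercolationContinuityZ3.Theorems.Transplant.SkelNegBParamsRootCasesT
import Summits.CriticalPhenomena.PercolationContinuityZ3.Theorems.Transplant.SkelNegBParamsSlotsSU
import Summits.CriticalPhenomena.PercolationContinuityZ3.Theorems.Transplant.SkelPhiFaceSlots
import HarnessLib

/-!
# N1 params, chain of record `NegB`, part Residuals: THE RESIDUAL SLOT VALUES OF RECORD — `NegB.exR : GSlot` (the `L′/E₀` floor: a SUM dominating every `ex`-floor
# the three residues posted), `NegB.mxR : GSlot` (the excess diameter ⊇ hp-8's `mF`), `NegB.KS.gxR/fxR := FSlot.zero`; the kit index of record `mk := 0`; and the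
# floor facts at `exR` (`floors_exR`), with the per-case reach bounds of the root residue (`Yb`, `core1Lo_l1_*`, `yL_l1_*`)

The node-level choice function of record is `negChoiceAllOT (KS.gT 0 gxR) (KS.fT 0 fxR) (KS.PR 0 Px) (NegB.SU exR mxR)` (`Px := PSlot.empty` unless a residue lists more pairs).

builds on p205010 (kernel theorem, internal audit signed; external expert review pending) — nothing in this file uses p205010; NOTHING is claimed about
the node `SamePDropOfSkeletonNeg₁` (OPEN).
Lane `prim-bschramm-*`, seat `prim-bschramm-stmt` (gen 14); helper file (`--supports stmt-CriticalPhenomena-4575 --as helper`); ledger HOME/prim-bschramm-stmt/NEG-PARAMS.md v0.13.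
[cite: KozmaNitzan2024, §4 Theorem 6 (pp. 25–31): the order of constants]
-/

noncomputable section

open scoped Classical

namespace Summit.CriticalPhenomena.PercolationContinuityZ3.Theorems.Transplant

namespace PlanarSkeletonNeg

namespace NegB

open Literature.Probability.Percolation Literature.Probability.LatticeModels SimpleGraph
open SkelConc (Consts)
open Skelφ (shearUnit sgnz sgnz_cases)
open Skelφ.StepI (DataN)
open ChainPlanar (BridgePrm)
open TwoAxis.Para (modulus)
open Neg

/-! ## §1 The values -/

section Values

variable (κ : Consts) {V : Type} [DecidableEq V] [Countable V] {G : SimpleGraph V} [G.LocallyFinite] (Φ : PlanarSkeletonNeg G) (t : V)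
  (p : unitInterval) (D : DataN V) (g f : ℕ)

/-- The long prism radius `Rl := D.R (pgScale n_L h_L (3ℓ_L))`. [this work] -/
def Rl : ℕ := D.R (D.scale t (ML κ Φ t p D g) (nL κ Φ t p D g f))

/-- The bridge prism radius at kit index `0`: `Rb := D.R (pgScale n_b h_b (3ℓ_b))`. [this work] -/
def Rb : ℕ := D.R (D.scale t (KS.MBR κ Φ t p D 0) (KS.nBR κ Φ t p D 0))

/-- **A uniform planar reach bound of the root chain's frames** `Yb := 2(n_L + |h_L| + ℓ_L + RA′ + S + 11)`, `S := n_b + ℓ_b + |h_b|` (dominates `|core1Lo|₁` and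
`|yL|₁` in all three bridge cases). [this work] -/
def Yb : ℕ := 2 * (nL κ Φ t p D g f + (hL κ Φ t p D g f).natAbs + ℓL κ Φ t p D g f + KS.RA' κ Φ t p D 0 +
  (KS.nBR κ Φ t p D 0 + KS.ℓBR κ Φ t p D 0 + (KS.hBR κ Φ t p D 0).natAbs) + 11)

/-- p5-g9's (C) `E₀`-floor `exC := dC + (kq+3)·(800·(n_L + Q_w)) + 3` (`dC = 1`, `kq = 10`, `Q_w = n_Lℓ_L/U + 1`). [this work] -/
def exC : ℕ := 1 + 13 * (800 * (nL κ Φ t p D g f + KS.Wrun κ Φ t p D g f)) + 3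

/-- **THE `L′/E₀` RESIDUAL OF RECORD** (a sum dominating every posted floor: the root residue's `r₀A Rb + 1`, `r₀A Rl + 1`, `Rl + 1`, `Rb + 1`, `Yb + 1000·U + 1`;
(F)'s `r₀A Rl`, `RlevA + reachA`; (C)'s `exC`). [this work] -/
def exR : GSlot := fun κ _ _ _ _ _ Φ t p D g f =>
  KS.r₀A Φ t D 0 (Rb κ Φ t p D) + KS.r₀A Φ t D 0 (Rl κ Φ t p D g f) + Rl κ Φ t p D g f + Rb κ Φ t p D + (Yb κ Φ t p D g f + 1000 * shearUnit (nL κ Φ t p D g f) (hL κ Φ t p D g f)) +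
    exC κ Φ t p D g f + (KS.RlevA κ Φ t p D 0 + KS.reachA t D 0) + 10

/-- **THE EXCESS-DIAMETER RESIDUAL OF RECORD** `mxR := ⌈hp-8's mF⌉₊`. [this work] -/
def mxR : GSlot := fun κ _ _ _ _ _ Φ t p D g f => ((prF κ Φ t p D g f).mF (fcells κ Φ t p D g f)).toNat

/-- The box residual of record: none beyond the landed floors. [this work] -/
def gxR : Neg.FSlot := Neg.FSlot.zero

/-- The width residual of record: none beyond the landed floors. [this work] -/
def fxR : Neg.FSlot := Neg.FSlot.zero

/-- **Every posted `ex`-floor holds at `exR`.** [folklore] -/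
theorem floors_exR :
    KS.r₀A Φ t D 0 (Rb κ Φ t p D) + 1 ≤ exR κ Φ t p D g f ∧ KS.r₀A Φ t D 0 (Rl κ Φ t p D g f) + 1 ≤ exR κ Φ t p D g f ∧
    Rl κ Φ t p D g f + 1 ≤ exR κ Φ t p D g f ∧ Rb κ Φ t p D + 1 ≤ exR κ Φ t p D g f ∧
    Yb κ Φ t p D g f + 1000 * shearUnit (nL κ Φ t p D g f) (hL κ Φ t p D g f) + 1 ≤ exR κ Φ t p D g f ∧
    exC κ Φ t p D g f ≤ exR κ Φ t p D g f ∧ KS.RlevA κ Φ t p D 0 + KS.reachA t D 0 ≤ exR κ Φ t p D g f ∧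
    KS.r₀A Φ t D 0 (Rl κ Φ t p D g f) ≤ exR κ Φ t p D g f := by
  unfold exR; omega

/-- `mF ≤ mxR`. [folklore] -/
theorem mF_le_mxR : (prF κ Φ t p D g f).mF (fcells κ Φ t p D g f) ≤ (mxR κ Φ t p D g f : ℤ) := by
  show _ ≤ ((Int.toNat _ : ℕ) : ℤ); exact Int.self_le_toNat _

end Values

/-! ## §2 The root residue's reach bounds (`hπ1`, `hπ2`) against `Yb` -/

namespace KS

section Reach

variable (κ : Consts) {V : Type} [DecidableEq V] [Countable V] {G : SimpleGraph V} [G.LocallyFinite] (Φ : PlanarSkeletonNeg G) (t : V)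
  (p : unitInterval) (D : DataN V) (g f : ℕ)

/-- `|core1Lo|₁ ≤ Yb` for the three frames at kit index `0`. [folklore] -/
theorem core1Lo_l1 {σ : ℤ} (hσ : σ = 1 ∨ σ = -1) (hℓb : 27 ≤ ℓBR κ Φ t p D 0) :
    ((Skelφ.bridgeSame σ (nL κ Φ t p D g f) (hL κ Φ t p D g f) (ℓL κ Φ t p D g f) (RA' κ Φ t p D 0) (nBR κ Φ t p D 0) (hBR κ Φ t p D 0) (ℓBR κ Φ t p D 0)).core1Lo 0).natAbs +
        ((Skelφ.bridgeSame σ (nL κ Φ t p D g f) (hL κ Φ t p D g f) (ℓL κ Φ t p D g f) (RA' κ Φ t p D 0) (nBR κ Φ t p D 0) (hBR κ Φ t p D 0) (ℓBR κ Φ t p D 0)).core1Lo 1).natAbs ≤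
      Yb κ Φ t p D g f ∧
    ((Skelφ.bridgeTrSide σ (nL κ Φ t p D g f) (hL κ Φ t p D g f) (ℓL κ Φ t p D g f) (RA' κ Φ t p D 0) (nBR κ Φ t p D 0) (hBR κ Φ t p D 0) (ℓBR κ Φ t p D 0)).core1Lo 0).natAbs +
        ((Skelφ.bridgeTrSide σ (nL κ Φ t p D g f) (hL κ Φ t p D g f) (ℓL κ Φ t p D g f) (RA' κ Φ t p D 0) (nBR κ Φ t p D 0) (hBR κ Φ t p D 0) (ℓBR κ Φ t p D 0)).core1Lo 1).natAbs ≤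
      Yb κ Φ t p D g f ∧
    ((Skelφ.bridgeTrTop σ (nL κ Φ t p D g f) (hL κ Φ t p D g f) (ℓL κ Φ t p D g f) (RA' κ Φ t p D 0) (nBR κ Φ t p D 0) (hBR κ Φ t p D 0) (ℓBR κ Φ t p D 0)).core1Lo 0).natAbs +
        ((Skelφ.bridgeTrTop σ (nL κ Φ t p D g f) (hL κ Φ t p D g f) (ℓL κ Φ t p D g f) (RA' κ Φ t p D 0) (nBR κ Φ t p D 0) (hBR κ Φ t p D 0) (ℓBR κ Φ t p D 0)).core1Lo 1).natAbs ≤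
      Yb κ Φ t p D g f := by
  have hσ' : |σ| = 1 := by rcases hσ with h | h <;> simp [h]
  have hs : |sgnz (hBR κ Φ t p D 0)| = 1 := by rcases sgnz_cases (hBR κ Φ t p D 0) with h | h <;> simp [h]
  have hY : (Yb κ Φ t p D g f : ℤ) = 2 * ((nL κ Φ t p D g f : ℤ) + |hL κ Φ t p D g f| + ℓL κ Φ t p D g f + RA' κ Φ t p D 0 +
      ((nBR κ Φ t p D 0 : ℤ) + ℓBR κ Φ t p D 0 + |hBR κ Φ t p D 0|) + 11) := by unfold Yb; push_cast [Int.natCast_natAbs]; ring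
  have hℓb' : (27 : ℤ) ≤ ℓBR κ Φ t p D 0 := by exact_mod_cast hℓb
  have key : ∀ a b : ℤ, |a| + |b| ≤ (Yb κ Φ t p D g f : ℤ) → a.natAbs + b.natAbs ≤ Yb κ Φ t p D g f := fun a b h => by
    have : ((a.natAbs + b.natAbs : ℕ) : ℤ) ≤ (Yb κ Φ t p D g f : ℤ) := by push_cast [Int.natCast_natAbs]; exact h
    exact_mod_cast this
  have hσh : |σ * hL κ Φ t p D g f| = |hL κ Φ t p D g f| := by rw [abs_mul, hσ', one_mul]
  have hσb : |σ * hBR κ Φ t p D 0| = |hBR κ Φ t p D 0| := by rw [abs_mul, hσ', one_mul]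
  have hσs : |σ * sgnz (hBR κ Φ t p D 0) * nBR κ Φ t p D 0| = nBR κ Φ t p D 0 := by rw [abs_mul, abs_mul, hσ', hs, one_mul, one_mul, Nat.abs_cast]
  have hRA : (0 : ℤ) ≤ (RA' κ Φ t p D 0 : ℤ) := by positivity
  have hn : (0 : ℤ) ≤ (nL κ Φ t p D g f : ℤ) := by positivity
  have hnb : (0 : ℤ) ≤ (nBR κ Φ t p D 0 : ℤ) := by positivity
  have hℓL : (0 : ℤ) ≤ (ℓL κ Φ t p D g f : ℤ) := by positivity
  obtain ⟨hh1, hh2⟩ := abs_le.1 (le_of_eq hσh)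
  obtain ⟨hb1, hb2⟩ := abs_le.1 (le_of_eq hσb)
  obtain ⟨hs1, hs2⟩ := abs_le.1 (le_of_eq hσs)
  have hha := abs_nonneg (hL κ Φ t p D g f)
  have hba := abs_nonneg (hBR κ Φ t p D 0)
  refine ⟨key _ _ ?_, key _ _ ?_, key _ _ ?_⟩
  · unfold ChainPlanar.BridgePrm.core1Lo Skelφ.bridgeSame
    simp only [Pi.add_apply, Pi.sub_apply, Skelφ.pt_zero, Skelφ.pt_one, Pi.natCast_apply]
    rw [hY]
    have ha : |(nL κ Φ t p D g f : ℤ) - (RA' κ Φ t p D 0 : ℕ) + nBR κ Φ t p D 0| ≤ nL κ Φ t p D g f + RA' κ Φ t p D 0 + nBR κ Φ t p D 0 :=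
      abs_le.2 ⟨by linarith, by linarith⟩
    have hb : |σ * hL κ Φ t p D g f - (RA' κ Φ t p D 0 : ℕ) + σ * hBR κ Φ t p D 0| ≤ |hL κ Φ t p D g f| + RA' κ Φ t p D 0 + |hBR κ Φ t p D 0| :=
      abs_le.2 ⟨by linarith, by linarith⟩
    linarith
  · unfold ChainPlanar.BridgePrm.core1Lo Skelφ.bridgeTrSide
    simp only [Pi.add_apply, Pi.sub_apply, Skelφ.pt_zero, Skelφ.pt_one, Pi.natCast_apply]
    rw [hY]
    have ha : |(nL κ Φ t p D g f : ℤ) - (RA' κ Φ t p D 0 : ℕ) + (|hBR κ Φ t p D 0|)| ≤ nL κ Φ t p D g f + RA' κ Φ t p D 0 + |hBR κ Φ t p D 0| :=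
      abs_le.2 ⟨by linarith, by linarith⟩
    have hb : |σ * hL κ Φ t p D g f - (RA' κ Φ t p D 0 : ℕ) + σ * sgnz (hBR κ Φ t p D 0) * nBR κ Φ t p D 0| ≤ |hL κ Φ t p D g f| + RA' κ Φ t p D 0 + nBR κ Φ t p D 0 :=
      abs_le.2 ⟨by linarith, by linarith⟩
    linarith
  · unfold ChainPlanar.BridgePrm.core1Lo Skelφ.bridgeTrTop
    simp only [Pi.add_apply, Pi.sub_apply, Skelφ.pt_zero, Skelφ.pt_one, Pi.natCast_apply]
    rw [hY]
    have ha : |(nL κ Φ t p D g f : ℤ) - (RA' κ Φ t p D 0 : ℕ) + ((ℓBR κ Φ t p D 0 : ℤ) - |hBR κ Φ t p D 0| - 11)| ≤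
        nL κ Φ t p D g f + RA' κ Φ t p D 0 + ℓBR κ Φ t p D 0 + |hBR κ Φ t p D 0| + 11 :=
      abs_le.2 ⟨by linarith, by linarith⟩
    have hb : |σ * hL κ Φ t p D g f - (RA' κ Φ t p D 0 : ℕ) + -(nBR κ Φ t p D 0 : ℤ)| ≤ |hL κ Φ t p D g f| + RA' κ Φ t p D 0 + nBR κ Φ t p D 0 :=
      abs_le.2 ⟨by linarith, by linarith⟩
    linarith

/-- `|yL|₁ ≤ Yb` for the three origins at kit index `0` (uses `|d|, mh ≤ …`). [folklore] -/
theorem yL_l1 {σ : ℤ} (hσ : σ = 1 ∨ σ = -1) (hℓb : 27 ≤ ℓBR κ Φ t p D 0) :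
    (yLs κ Φ t p D g f 0 σ 0).natAbs + (yLs κ Φ t p D g f 0 σ 1).natAbs ≤ Yb κ Φ t p D g f ∧
      (yLd κ Φ t p D g f 0 σ 0).natAbs + (yLd κ Φ t p D g f 0 σ 1).natAbs ≤ Yb κ Φ t p D g f ∧
      (yLt κ Φ t p D g f 0 σ 0).natAbs + (yLt κ Φ t p D g f 0 σ 1).natAbs ≤ Yb κ Φ t p D g f := by
  have h1 := yLof_l1 κ Φ t p D g f hσ (nBR κ Φ t p D 0 : ℤ) (hBR κ Φ t p D 0) (mhs κ Φ t p D g f 0)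
  have h2 := yLof_l1 κ Φ t p D g f hσ (d0d κ Φ t p D 0) (sgnz (hBR κ Φ t p D 0) * nBR κ Φ t p D 0) ((ℓL κ Φ t p D g f : ℤ) / 2)
  have h3 := yLof_l1 κ Φ t p D g f hσ ((ℓBR κ Φ t p D 0 : ℤ) - 5) 0 ((ℓL κ Φ t p D g f : ℤ) / 2)
  have hs := sgnz_cases (hBR κ Φ t p D 0)
  have e1 : (mhs κ Φ t p D g f 0).natAbs ≤ ℓL κ Φ t p D g f + ℓBR κ Φ t p D 0 := by unfold mhs; omega
  have hcast : (((hBR κ Φ t p D 0).natAbs : ℕ) : ℤ) = |hBR κ Φ t p D 0| := Int.natCast_natAbs _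
  have hba := abs_nonneg (hBR κ Φ t p D 0)
  have e2 : (d0d κ Φ t p D 0).natAbs ≤ ℓBR κ Φ t p D 0 + (hBR κ Φ t p D 0).natAbs := by unfold d0d; omega
  have e3 : (sgnz (hBR κ Φ t p D 0) * (nBR κ Φ t p D 0 : ℤ)).natAbs = nBR κ Φ t p D 0 := by
    rcases hs with h | h <;> simp [h]
  have e4 : (((ℓL κ Φ t p D g f : ℤ) / 2)).natAbs ≤ ℓL κ Φ t p D g f := by omega
  have e5 : (((ℓBR κ Φ t p D 0 : ℤ) - 5)).natAbs ≤ ℓBR κ Φ t p D 0 := by omega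
  have e6 : ((nBR κ Φ t p D 0 : ℕ) : ℤ).natAbs = nBR κ Φ t p D 0 := Int.natAbs_natCast _
  have e7 : (0 : ℤ).natAbs = 0 := rfl
  unfold yLs yLd yLt Yb
  refine ⟨le_trans h1 ?_, le_trans h2 ?_, le_trans h3 ?_⟩
  · rw [e6]; omega
  · rw [e3]; omega
  · rw [e7]; omega

end Reach

end KS

end NegB

end PlanarSkeletonNeg

end Summit.CriticalPhenomena.PercolationContinuityZ3.Theorems.Transplant
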